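import Summits.QuantumFields.BalabanUV.Beta.FP.PolarizationGermLegs
import Summits.QuantumFields.BalabanUV.Beta.FP.ExpLocalisedBubbleKernel

/-!
# `BalabanUV.Beta.FP.PolarizationGerm` — road «FP» for binder row D1, leaf (H2), row **H2-ASM-3b** (module 2 of 2): THE END OF «KERNEL BUBBLE ⟹ GERM BUBBLE» —
# for an ABSTRACT leg with displayed graded and dictionary letters and an admissible cubic family, the one-loop bubble of `ExpKernelCalculus` IS FILE 1's
# `leadGerm cL (cubicGermOf V)` (`= −(cL²∕2)·bubble L L` for Bose germs: the letter `aB = ¼` of H2-ASM-4) up to `Cbub∕‖z‖∞⁷`; ghost twin with `cubicGermOfSc` ∕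
# `leadGermSc` (`aG = −½`); the tadpole under (W-loc); the `hessKer` triangle ([folklore] assembly BY NAME; nothing of the manuscripts)

HONEST DEPENDENCY (page 1, mandatory): continuum YM on T⁴ ⇐ BetaPertH ∧ nine spine estimates (0/9 proved); BetaPertH ⇐ (D1) ∧ (D4) ∧ CAP+tail;
G-an2-4 gates asym, D1 and NE2/3/4.  HONEST FRAMING (cell contract, verbatim): «discharging `BetaPertH` makes Bałaban's UV stability UNCONDITIONAL —
a real constructive-QFT result; it is NOT the continuum limit and NOT the Clay problem.»  THIS MODULE DISCHARGES NOTHING of the wall: it composes, BY NAME,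
the H2-ASM-1 engine's END (beta-d1-formalise-leaf-02: `ExpLocalisedBubbleKernel.abs_bubble_kernel_sub_lead_le`) with module 1 (`PolarizationGermLegs`: field-block
reduction, `leadOf`, Kronecker collapse, leg-replacement estimate, graded sum, constants) and FILE 1 (`PolarizationGermBubble`: the moment dictionary, `leadGerm`);
every analytic input — the leg's boundedness, translation invariance, off-block vanishing, graded letters to third differences and dictionary letters to second
differences, the vertex family's localisation (a1), translation covariance (a2) and zero total mass (a3, total form E-FP-7-1), the quartic table's joint localisation
(W-loc, E-FP-8-1) — is a HYPOTHESIS displayed in the signatures; 0 def, 0 `def … : Prop`, nothing cited, 0 sorry; 0∕4 row-D1 binders; NOT the `Pker`∕`G0ker` INSTANCE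
(H2-ASM-2 ✓ 4∕4 supplies `Pker`'s letters — `PerfectPropagatorLegData(Products)` — and H2-ASM-5 plugs them), NOT `hgerm`, NOT D1, NOT BetaPertH, NOT continuum, NOT Clay.

ABSOLUTE RULE (cell charter, verbatim): «No internally-minted statement may enter as a cited fact. Every hypothesis is either kernel-proved in this package or a
verbatim quotation of a PUBLISHED theorem with page reference. The manuscript(s) under audit are NOT citable for their own disputed steps — they are the thing
under adjudication; programme-internal (2001/route/tribunal) claims are never citable.»

THE ROW (owner memo `HOME/b2b-balaban-beta-d1-p3/H2V-DESIGN.md` f78878bd5f8d2d18 §4 H2-ASM-3; owner split journal l.25851 — 3a = FILE 1 ✓ p246050, 3b = this END; R-FP-30: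
the γ road consumes `K = PiBF` through (K6), (Kev), (K0) and `hgerm`; the germ expansion below is the `hgerm` input at relative order `‖z‖⁻¹`).
* §1 [our object] **`abs_bubble_sub_leadGerm_le`** — GLUON SECTOR, generic leg `A : MKer 4 (Fib 3)`: bounded (`CA`), translation invariant, vanishing off the field block
  (`Pker_inl_inr`∕`_inr_inl`∕`_inr_inr` shape), GRADED letters `|F| ≤ A₀∕(‖t‖∞+1)²`, `|ΔF| ≤ A₁∕(…)³`, `|ΔΔF| ≤ A₂∕(…)⁴`, `|ΔΔΔF| ≤ A₃∕(…)⁵` for BOTH orientations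
  `F = v ↦ A 0 (−v) (inl α)(inl β)` and `G = v ↦ A 0 v (inl α)(inl β)` (= the engine's `hF`∕`hG` at `a = b = 2`), DICTIONARY letters on `R₀ ≤ ‖t‖∞` (`1 ≤ R₀`):
  `|F(t) − δ_{αβ}·cL·ℓ₀(X)| ≤ D₀∕‖t‖³`, `|Δ_iF(t) − δ_{αβ}·cL·∂_iℓ₀(X)| ≤ D₁∕‖t‖⁴`, `|Δ_iΔ_jF(t) − δ_{αβ}·cL·∂_i∂_jℓ₀(X)| ≤ D₂∕‖t‖⁵` (`X = toReal t`;
  `ℓ₀, ∂ℓ₀, ∂∂ℓ₀ = BubbleTransfer.invSq ∕ d1InvSq ∕ hessInvSq`; for `Pker`: `cL = c₄`, H2-ASM-2 (D0)–(D2) + (L0)–(L3)); vertex family `LocStencil V Cs δ` + (a2) + (a3) ⟹ for all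
  `μ ν` and `R₀ ≤ ‖z‖∞`: **`|bubble A (V μ 0) (V ν z) − leadGerm cL (cubicGermOf V) μ ν (toReal z)| ≤ Cbub 4 Cs δ A₀ A₁ A₂ A₃ D₀ D₁ D₂ ∕ ‖z‖∞⁷`**, `Cbub` explicit in module 1
  (`4⁴·KR₂ + 4⁴·16·Mb²·Kd`: the engine's remainder constant at degrees (2,2), the germ bound `Mb` of `abs_cubicGermOf_le`, `Kd = 2(D₀A₂+D₀D₂+A₀D₂) + 2(D₁A₁+D₁²+A₁D₁)`).
  ROUTE: `bubble_eq_fblk` → the engine on the field blocks → FILE 1's moment dictionary turns the engine's `Σ Lead` into `leadOf` at the GERM moment tables (`simpa only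
  [leadOf]`) → `abs_leadOf_sub_leadOf_le` with the graded∕dictionary letters AT `z` (bare `‖z‖∞` currency, `div_succ_pow_le`) → `leadOf_kron_eq_leadGerm` → `graded_sum_le`.
* §2 [our object] **`abs_bubble_sub_leadGermSc_le`** — GHOST SECTOR (`Φ = Unit`, generic scalar leg, scalar family `v` with `BiLoc (v λ u) u u Cs δ` + (a2) + (a3)): the same with
  `cG·(ℓ₀, ∂ℓ₀, ∂∂ℓ₀)` (no Kronecker), `cubicGermOfSc`, `leadGermSc`, constant `Cbub 1 …` (for `G0ker`: `cG = c₄`; for `v = ghCur`: `cubicGermOfSc ghCur = ghostGerm`, H2V-3).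
* §3 [folklore] `abs_half_tadpole_le` (the tadpole face under (W-loc): `|½·tadpole A (W μ 0 ν z)| ≤ ½·|Φ|²·(Cw·e^{−δ|z|₁}·Θ δ 0·CA)`), `abs_hessKer_shape_le` (the triangle for
  `hessKer = ½·tadpole − ½·bubble` against `−½·leadGerm`).  With FILE 1: `−½·leadGerm cL (cQ•bfGerm) = cL²·(¼·bubble (cQ•bfGerm) (cQ•bfGerm))`, `−½·leadGermSc cG ghostGerm =
  cG²·(−½·ghostLoop)` — the face of `PolarizationColour` at `(aB, aG) = (¼, −½)`.
WHAT IT IS NOT: no `PiBF`-level statement (H2-ASM-5, owner: plug `Pker`∕`G0ker`∕`ghCur`∕the admissible `V3 + sliceV3` and read `hgerm`); no claim on the perfect action's jets.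
Provenance: G-an2-4 formalisation swarm seat b2b-balaban-gan24-formalise-leaf-02 gen 39 (cross-lane on road FP; row H2-ASM-3b, owner GO journal l.25851), 2026-08-21.
-/

noncomputable section

namespace Summit.QuantumFields.BalabanUV.Beta.FP.PolarizationGerm

open Finset fwdDiff
open scoped BigOperators
open Literature.MathematicalPhysics.QuantumFieldTheory.Balaban1983to89
open Literature.MathematicalPhysics.QuantumFieldTheory.Balaban1983to89.Beta
open Literature.MathematicalPhysics.QuantumFieldTheory.Balaban1983to89.Beta.TransverseStructure
open Literature.MathematicalPhysics.QuantumFieldTheory.Balaban1983to89.Beta.BubbleTransfer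
open B12Sec2to5 (l1 l1_nonneg)
open ExpKernelCalculus (Site MKer Zl Zl_pos BiLoc bubble tadpole hessKer shiftK)
open OneStepResolventKernel (Fib LocStencil)
open DyadicShell (Pt supNorm toReal supNorm_pos supNorm_eq_zero_iff)
open Summit.QuantumFields.BalabanUV.Beta.FP.MarginalUniqueness (Idx CubicGerm)

open Summit.QuantumFields.BalabanUV.Beta.FP.WilsonCubicGerm (cubicGermOf)
open Summit.QuantumFields.BalabanUV.Beta.FP.GhostCubicGerm (cubicGermOfSc)
open Summit.QuantumFields.BalabanUV.Beta.FP.CubicGermFunctional (abs_cubicGermOf_le)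
open Summit.QuantumFields.BalabanUV.Beta.FP.PolarizationGermBubble (leadGerm leadGermSc tsum_fst_moment tsum_snd_moment tsum_recentred_fst_moment
  tsum_recentred_snd_moment tsum_fst_moment_sc tsum_snd_moment_sc tsum_recentred_fst_moment_sc tsum_recentred_snd_moment_sc)
open Summit.QuantumFields.BalabanUV.Beta.FP.PolarizationGermLegs
open Summit.QuantumFields.BalabanUV.Beta.FP.ExpLocalisedBubbleOrder2Point (Θ)
open Summit.QuantumFields.BalabanUV.Beta.FP.ExpLocalisedBubbleKernel (abs_bubble_kernel_sub_lead_le)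

/-! ## §1 THE END, gluon sector: the one-loop bubble of an admissible family on an abstract leg = `leadGerm` + `O(‖z‖∞⁻⁷)` -/

section Gluon

variable {A : MKer 4 (Fib 3)} {V : Fin 4 → Site 4 → MKer 4 (Fib 3)} {CA Cs δ cL A₀ A₁ A₂ A₃ D₀ D₁ D₂ : ℝ} {R₀ : ℕ}

/-- [our object] **THE END OF H2-ASM-3, GLUON SECTOR** (generic leg).  Leg `A` on the packed fibre of `ℤ⁴`: bounded, translation invariant, vanishing off the field block,
with the GRADED letters to third differences (`(‖t‖∞+1)^{−2,−3,−4,−5}`, both orientations `v ↦ A 0 (−v) (inl α)(inl β)` and `v ↦ A 0 v (inl α)(inl β)`) and the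
DICTIONARY letters against `cL·δ_{αβ}·(ℓ₀, ∂ℓ₀, ∂∂ℓ₀)` at relative orders `‖t‖∞^{−3,−4,−5}` on `R₀ ≤ ‖t‖∞` (`1 ≤ R₀`); vertex family `V`: `LocStencil V Cs δ` (a1),
translation covariant (a2), zero total mass on the field block (a3, total form E-FP-7-1).  THEN for every `μ ν` and every `z` with `R₀ ≤ ‖z‖∞`:
`|bubble A (V μ 0) (V ν z) − leadGerm cL (cubicGermOf V) μ ν (toReal z)| ≤ Cbub 4 Cs δ A₀ A₁ A₂ A₃ D₀ D₁ D₂ ∕ ‖z‖∞⁷`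
(the engine's part D BY NAME on the field blocks + module 1's leg replacement + FILE 1's germ identity; `leadGerm = −(cL²∕2)·bubble L L` for Bose germs, FILE 1). -/
theorem abs_bubble_sub_leadGerm_le (hδ : 0 < δ) (hA : ∀ x y a b, |A x y a b| ≤ CA) (hT : ∀ v : Site 4, shiftK v A = A)
    (hio : ∀ x y α m, A x y (Sum.inl α) (Sum.inr m) = 0) (hoi : ∀ x y m α, A x y (Sum.inr m) (Sum.inl α) = 0)
    (hoo : ∀ x y m m', A x y (Sum.inr m) (Sum.inr m') = 0)
    (hF : ∀ (α β : Fin 4) (t : Pt), |A 0 (-t) (Sum.inl α) (Sum.inl β)| ≤ A₀ / ((supNorm t : ℝ) + 1) ^ 2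
      ∧ (∀ i, |Δ_[(Pi.single i 1 : Pt)] (fun v => A 0 (-v) (Sum.inl α) (Sum.inl β)) t| ≤ A₁ / ((supNorm t : ℝ) + 1) ^ 3)
      ∧ (∀ i j, |Δ_[(Pi.single i 1 : Pt)] (Δ_[(Pi.single j 1 : Pt)] (fun v => A 0 (-v) (Sum.inl α) (Sum.inl β))) t| ≤ A₂ / ((supNorm t : ℝ) + 1) ^ 4)
      ∧ (∀ i j l, |Δ_[(Pi.single i 1 : Pt)] (Δ_[(Pi.single j 1 : Pt)] (Δ_[(Pi.single l 1 : Pt)] (fun v => A 0 (-v) (Sum.inl α) (Sum.inl β)))) t|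
          ≤ A₃ / ((supNorm t : ℝ) + 1) ^ 5))
    (hG : ∀ (α β : Fin 4) (t : Pt), |A 0 t (Sum.inl α) (Sum.inl β)| ≤ A₀ / ((supNorm t : ℝ) + 1) ^ 2
      ∧ (∀ i, |Δ_[(Pi.single i 1 : Pt)] (fun v => A 0 v (Sum.inl α) (Sum.inl β)) t| ≤ A₁ / ((supNorm t : ℝ) + 1) ^ 3)
      ∧ (∀ i j, |Δ_[(Pi.single i 1 : Pt)] (Δ_[(Pi.single j 1 : Pt)] (fun v => A 0 v (Sum.inl α) (Sum.inl β))) t| ≤ A₂ / ((supNorm t : ℝ) + 1) ^ 4)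
      ∧ (∀ i j l, |Δ_[(Pi.single i 1 : Pt)] (Δ_[(Pi.single j 1 : Pt)] (Δ_[(Pi.single l 1 : Pt)] (fun v => A 0 v (Sum.inl α) (Sum.inl β)))) t|
          ≤ A₃ / ((supNorm t : ℝ) + 1) ^ 5))
    (hR₀ : 1 ≤ R₀)
    (hDF : ∀ (α β : Fin 4) (t : Pt), R₀ ≤ supNorm t →
      |A 0 (-t) (Sum.inl α) (Sum.inl β) - MarginalUniqueness.δ α β * (cL * invSq (toReal t))| ≤ D₀ / (supNorm t : ℝ) ^ 3
      ∧ (∀ i, |Δ_[(Pi.single i 1 : Pt)] (fun v => A 0 (-v) (Sum.inl α) (Sum.inl β)) t - MarginalUniqueness.δ α β * (cL * d1InvSq i (toReal t))| ≤ D₁ / (supNorm t : ℝ) ^ 4)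
      ∧ (∀ i j, |Δ_[(Pi.single i 1 : Pt)] (Δ_[(Pi.single j 1 : Pt)] (fun v => A 0 (-v) (Sum.inl α) (Sum.inl β))) t - MarginalUniqueness.δ α β * (cL * hessInvSq i j (toReal t))|
          ≤ D₂ / (supNorm t : ℝ) ^ 5))
    (hDG : ∀ (α β : Fin 4) (t : Pt), R₀ ≤ supNorm t →
      |A 0 t (Sum.inl α) (Sum.inl β) - MarginalUniqueness.δ α β * (cL * invSq (toReal t))| ≤ D₀ / (supNorm t : ℝ) ^ 3
      ∧ (∀ i, |Δ_[(Pi.single i 1 : Pt)] (fun v => A 0 v (Sum.inl α) (Sum.inl β)) t - MarginalUniqueness.δ α β * (cL * d1InvSq i (toReal t))| ≤ D₁ / (supNorm t : ℝ) ^ 4)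
      ∧ (∀ i j, |Δ_[(Pi.single i 1 : Pt)] (Δ_[(Pi.single j 1 : Pt)] (fun v => A 0 v (Sum.inl α) (Sum.inl β))) t - MarginalUniqueness.δ α β * (cL * hessInvSq i j (toReal t))|
          ≤ D₂ / (supNorm t : ℝ) ^ 5))
    (hV : LocStencil V Cs δ) (hcov : ∀ (lam : Fin 4) (w : Site 4), V lam w = shiftK (-w) (V lam 0))
    (h0 : ∀ (lam α β : Fin 4), ∑' p : Pt × Pt, V lam 0 p.1 p.2 (Sum.inl α) (Sum.inl β) = 0)
    (μ ν : Fin 4) {z : Pt} (hz : R₀ ≤ supNorm z) :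
    |bubble A (V μ 0) (V ν z) - leadGerm cL (cubicGermOf V) μ ν (toReal z)| ≤ Cbub 4 Cs δ A₀ A₁ A₂ A₃ D₀ D₁ D₂ / (supNorm z : ℝ) ^ 7 := by
  -- the currency
  have hs1 : (1 : ℝ) ≤ supNorm z := by exact_mod_cast le_trans hR₀ hz
  have hs : (0 : ℝ) < supNorm z := by linarith
  set s : ℝ := (supNorm z : ℝ) with hsdef
  set x : E4 := toReal z with hxdef
  -- (1) field-block reduction
  rw [bubble_eq_fblk hio hoi hoo]
  -- (2) the engine on the field blocks, degrees a = b = 2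
  have hA' : ∀ x' y a' b', |fblk A x' y a' b'| ≤ CA := fun x' y a' b' => hA x' y _ _
  have hT' : ∀ v : Pt, shiftK v (fblk A) = fblk A := fun v => by rw [← fblk_shiftK, hT]
  have hV₀ : BiLoc (fblk (V μ 0)) 0 0 Cs δ := biLoc_fblk (hV μ 0)
  have hV₁ : BiLoc (fblk (V ν z)) z z Cs δ := biLoc_fblk (hV ν z)
  have h0₀ : ∀ g f : Fin 4, ∑' p : Pt × Pt, fblk (V μ 0) p.1 p.2 g f = 0 := fun g f => h0 μ g f
  have h0₁ : ∀ h a : Fin 4, ∑' q : Pt × Pt, fblk (V ν z) q.1 q.2 h a = 0 := fun h a => tsum_member_eq_zero hcov h0 ν z h a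
  have hD := abs_bubble_kernel_sub_lead_le (A := fblk A) (V₀ := fblk (V μ 0)) (V₁ := fblk (V ν z)) (a := 2) (b := 2) (z := z)
    hδ hA' hT' hV₀ hV₁ h0₀ h0₁ (fun a' g t => hF a' g t) (fun f h t => hG f h t)
  -- (3) read the moments through FILE 1's dictionary: the engine's leading term IS `leadOf` at the germ's moment tables
  simp only [fblk_apply, tsum_fst_moment, tsum_snd_moment, tsum_recentred_fst_moment hcov, tsum_recentred_snd_moment hcov] at hD
  set m₀ : Fin 4 → Fin 4 → Idx → Fin 2 → ℝ := fun g f κ i => cubicGermOf V g f μ κ i with hm₀def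
  set m₁ : Fin 4 → Fin 4 → Idx → Fin 2 → ℝ := fun h a κ i => cubicGermOf V h a ν κ i with hm₁def
  set P : Fin 4 → Fin 4 → ℝ := fun a g => A 0 (-z) (Sum.inl a) (Sum.inl g) with hPdef
  set Q : Fin 4 → Fin 4 → ℝ := fun f h => A 0 z (Sum.inl f) (Sum.inl h) with hQdef
  set dF : Idx → Fin 4 → Fin 4 → ℝ := fun i a g => Δ_[(Pi.single i 1 : Pt)] (fun v => A 0 (-v) (Sum.inl a) (Sum.inl g)) z with hdFdef
  set dG : Idx → Fin 4 → Fin 4 → ℝ := fun j f h => Δ_[(Pi.single j 1 : Pt)] (fun v => A 0 v (Sum.inl f) (Sum.inl h)) z with hdGdef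
  set ddF : Idx → Idx → Fin 4 → Fin 4 → ℝ :=
    fun i j a g => Δ_[(Pi.single i 1 : Pt)] (Δ_[(Pi.single j 1 : Pt)] (fun v => A 0 (-v) (Sum.inl a) (Sum.inl g))) z with hddFdef
  set ddG : Idx → Idx → Fin 4 → Fin 4 → ℝ :=
    fun i j f h => Δ_[(Pi.single i 1 : Pt)] (Δ_[(Pi.single j 1 : Pt)] (fun v => A 0 v (Sum.inl f) (Sum.inl h))) z with hddGdef
  have hD' : |bubble (fblk A) (fblk (V μ 0)) (fblk (V ν z)) - leadOf m₀ m₁ P Q dF dG ddF ddG|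
      ≤ (Fintype.card (Fin 4) : ℝ) ^ 4 * KR₂ Cs δ A₀ A₁ A₂ A₃ / ((supNorm z : ℝ) + 1) ^ (2 + 2 + 3) := by
    simpa only [leadOf, KR₂] using hD
  -- (4) the leg replacement, all tables in the bare `s` currency
  have hA₀ : 0 ≤ A₀ := nonneg_of_abs_le_div (hG 0 0 z).1 (by positivity)
  have hA₁ : 0 ≤ A₁ := nonneg_of_abs_le_div ((hG 0 0 z).2.1 0) (by positivity)
  have hA₂ : 0 ≤ A₂ := nonneg_of_abs_le_div ((hG 0 0 z).2.2.1 0 0) (by positivity)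
  have hD₀ : 0 ≤ D₀ := nonneg_of_abs_le_div (hDG 0 0 z hz).1 (by positivity)
  have hD₁ : 0 ≤ D₁ := nonneg_of_abs_le_div ((hDG 0 0 z hz).2.1 0) (by positivity)
  have hD₂ : 0 ≤ D₂ := nonneg_of_abs_le_div ((hDG 0 0 z hz).2.2 0 0) (by positivity)
  have hP : ∀ a g, |P a g| ≤ A₀ / s ^ 2 := fun a g => ((hF a g z).1).trans (div_succ_pow_le hA₀ hs 2)
  have hQ : ∀ f h, |Q f h| ≤ A₀ / s ^ 2 := fun f h => ((hG f h z).1).trans (div_succ_pow_le hA₀ hs 2)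
  have hdF : ∀ i a g, |dF i a g| ≤ A₁ / s ^ 3 := fun i a g => (((hF a g z).2.1) i).trans (div_succ_pow_le hA₁ hs 3)
  have hdG : ∀ j f h, |dG j f h| ≤ A₁ / s ^ 3 := fun j f h => (((hG f h z).2.1) j).trans (div_succ_pow_le hA₁ hs 3)
  have hddF : ∀ i j a g, |ddF i j a g| ≤ A₂ / s ^ 4 := fun i j a g => (((hF a g z).2.2.1) i j).trans (div_succ_pow_le hA₂ hs 4)
  have hddG : ∀ i j f h, |ddG i j f h| ≤ A₂ / s ^ 4 := fun i j f h => (((hG f h z).2.2.1) i j).trans (div_succ_pow_le hA₂ hs 4)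
  have eP : ∀ a g, |P a g - MarginalUniqueness.δ a g * (cL * invSq x)| ≤ D₀ / s ^ 3 := fun a g => (hDF a g z hz).1
  have eQ : ∀ f h, |Q f h - MarginalUniqueness.δ f h * (cL * invSq x)| ≤ D₀ / s ^ 3 := fun f h => (hDG f h z hz).1
  have edF : ∀ i a g, |dF i a g - MarginalUniqueness.δ a g * (cL * d1InvSq i x)| ≤ D₁ / s ^ 4 := fun i a g => (hDF a g z hz).2.1 i
  have edG : ∀ j f h, |dG j f h - MarginalUniqueness.δ f h * (cL * d1InvSq j x)| ≤ D₁ / s ^ 4 := fun j f h => (hDG f h z hz).2.1 j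
  have eddF : ∀ i j a g, |ddF i j a g - MarginalUniqueness.δ a g * (cL * hessInvSq i j x)| ≤ D₂ / s ^ 5 := fun i j a g => (hDF a g z hz).2.2 i j
  have eddG : ∀ i j f h, |ddG i j f h - MarginalUniqueness.δ f h * (cL * hessInvSq i j x)| ≤ D₂ / s ^ 5 := fun i j f h => (hDG f h z hz).2.2 i j
  have hm₀ : ∀ g f κ i, |m₀ g f κ i| ≤ Cs * (Real.exp (δ / 2) * (2 / δ)) * Zl 4 (δ / 2) ^ 2 := fun g f κ i => abs_cubicGermOf_le hV hδ g f μ κ i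
  have hm₁ : ∀ h a κ i, |m₁ h a κ i| ≤ Cs * (Real.exp (δ / 2) * (2 / δ)) * Zl 4 (δ / 2) ^ 2 := fun h a κ i => abs_cubicGermOf_le hV hδ h a ν κ i
  have hL := abs_leadOf_sub_leadOf_le (P0 := fun a g => MarginalUniqueness.δ a g * (cL * invSq x)) (Q0 := fun f h => MarginalUniqueness.δ f h * (cL * invSq x))
    (dF0 := fun i a g => MarginalUniqueness.δ a g * (cL * d1InvSq i x)) (dG0 := fun j f h => MarginalUniqueness.δ f h * (cL * d1InvSq j x))
    (ddF0 := fun i j a g => MarginalUniqueness.δ a g * (cL * hessInvSq i j x)) (ddG0 := fun i j f h => MarginalUniqueness.δ f h * (cL * hessInvSq i j x))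
    hm₀ hm₁ hP hQ hdF hdG hddF hddG eP eQ edF edG eddF eddG
  rw [leadOf_kron_eq_leadGerm cL (cubicGermOf V) μ ν x] at hL
  -- (5) assemble
  have hKR : 0 ≤ KR₂ Cs δ A₀ A₁ A₂ A₃ := by
    have h1 := nonneg_of_abs_le_div hD' (by positivity)
    exact (mul_nonneg_iff_of_pos_left (by positivity)).mp h1
  have hsum := graded_sum_le hA₀ hA₁ hA₂ hD₀ hD₁ hD₂ hs1
  have hMb : 0 ≤ (Cs * (Real.exp (δ / 2) * (2 / δ)) * Zl 4 (δ / 2) ^ 2) ^ 2 := sq_nonneg _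
  calc |bubble (fblk A) (fblk (V μ 0)) (fblk (V ν z)) - leadGerm cL (cubicGermOf V) μ ν x|
      ≤ |bubble (fblk A) (fblk (V μ 0)) (fblk (V ν z)) - leadOf m₀ m₁ P Q dF dG ddF ddG|
          + |leadOf m₀ m₁ P Q dF dG ddF ddG - leadGerm cL (cubicGermOf V) μ ν x| := abs_sub_le _ _ _
    _ ≤ (Fintype.card (Fin 4) : ℝ) ^ 4 * KR₂ Cs δ A₀ A₁ A₂ A₃ / ((supNorm z : ℝ) + 1) ^ (2 + 2 + 3)
          + (Fintype.card (Fin 4) : ℝ) ^ 4 * (16 * ((Cs * (Real.exp (δ / 2) * (2 / δ)) * Zl 4 (δ / 2) ^ 2) ^ 2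
              * ((D₀ / s ^ 3 * (A₂ / s ^ 4) + D₀ / s ^ 3 * (D₂ / s ^ 5) + A₀ / s ^ 2 * (D₂ / s ^ 5))
                + (D₁ / s ^ 4 * (A₁ / s ^ 3) + D₁ / s ^ 4 * (D₁ / s ^ 4) + A₁ / s ^ 3 * (D₁ / s ^ 4))
                + (D₁ / s ^ 4 * (A₁ / s ^ 3) + D₁ / s ^ 4 * (D₁ / s ^ 4) + A₁ / s ^ 3 * (D₁ / s ^ 4))
                + (D₀ / s ^ 3 * (A₂ / s ^ 4) + D₀ / s ^ 3 * (D₂ / s ^ 5) + A₀ / s ^ 2 * (D₂ / s ^ 5))))) := add_le_add hD' hL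
    _ ≤ (4 : ℝ) ^ 4 * KR₂ Cs δ A₀ A₁ A₂ A₃ / s ^ 7
          + (4 : ℝ) ^ 4 * (16 * ((Cs * (Real.exp (δ / 2) * (2 / δ)) * Zl 4 (δ / 2) ^ 2) ^ 2 * (Kd A₀ A₁ A₂ D₀ D₁ D₂ / s ^ 7))) := by
        have e1 : (Fintype.card (Fin 4) : ℝ) ^ 4 = (4 : ℝ) ^ 4 := by simp
        rw [e1, show (2 : ℕ) + 2 + 3 = 7 from rfl, ← hsdef]
        refine add_le_add (div_succ_pow_le (mul_nonneg (by norm_num) hKR) hs 7) ?_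
        exact mul_le_mul_of_nonneg_left (mul_le_mul_of_nonneg_left (mul_le_mul_of_nonneg_left hsum hMb) (by norm_num)) (by norm_num)
    _ = Cbub 4 Cs δ A₀ A₁ A₂ A₃ D₀ D₁ D₂ / s ^ 7 := by
        unfold Cbub; push_cast; ring

end Gluon

/-! ## §2 THE END, ghost sector (scalar fibre): the same with `cubicGermOfSc`, `leadGermSc`, no Kronecker, `|Φ| = 1` -/

section Ghost

variable {A : MKer 4 Unit} {v : Fin 4 → Site 4 → MKer 4 Unit} {CA Cs δ cG A₀ A₁ A₂ A₃ D₀ D₁ D₂ : ℝ} {R₀ : ℕ}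

/-- [our object] **THE END OF H2-ASM-3, GHOST SECTOR** (generic scalar leg `A`, e.g. `G0ker`; scalar cubic family `v`, e.g. `ghCur` with `cubicGermOfSc ghCur = ghostGerm`, H2V-3):
same letters without the Kronecker (`cG·(ℓ₀, ∂ℓ₀, ∂∂ℓ₀)`), THEN `|bubble A (v μ 0) (v ν z) − leadGermSc cG (cubicGermOfSc v) μ ν (toReal z)| ≤ Cbub 1 Cs δ A₀ A₁ A₂ A₃ D₀ D₁ D₂ ∕ ‖z‖∞⁷`
on `R₀ ≤ ‖z‖∞` (`leadGermSc cG ghostGerm = −2·cG²·(−½·ghostLoop)`, FILE 1). -/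
theorem abs_bubble_sub_leadGermSc_le (hδ : 0 < δ) (hA : ∀ x y a b, |A x y a b| ≤ CA) (hT : ∀ w : Site 4, shiftK w A = A)
    (hF : ∀ t : Pt, |A 0 (-t) () ()| ≤ A₀ / ((supNorm t : ℝ) + 1) ^ 2
      ∧ (∀ i, |Δ_[(Pi.single i 1 : Pt)] (fun w => A 0 (-w) () ()) t| ≤ A₁ / ((supNorm t : ℝ) + 1) ^ 3)
      ∧ (∀ i j, |Δ_[(Pi.single i 1 : Pt)] (Δ_[(Pi.single j 1 : Pt)] (fun w => A 0 (-w) () ())) t| ≤ A₂ / ((supNorm t : ℝ) + 1) ^ 4)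
      ∧ (∀ i j l, |Δ_[(Pi.single i 1 : Pt)] (Δ_[(Pi.single j 1 : Pt)] (Δ_[(Pi.single l 1 : Pt)] (fun w => A 0 (-w) () ()))) t|
          ≤ A₃ / ((supNorm t : ℝ) + 1) ^ 5))
    (hG : ∀ t : Pt, |A 0 t () ()| ≤ A₀ / ((supNorm t : ℝ) + 1) ^ 2
      ∧ (∀ i, |Δ_[(Pi.single i 1 : Pt)] (fun w => A 0 w () ()) t| ≤ A₁ / ((supNorm t : ℝ) + 1) ^ 3)
      ∧ (∀ i j, |Δ_[(Pi.single i 1 : Pt)] (Δ_[(Pi.single j 1 : Pt)] (fun w => A 0 w () ())) t| ≤ A₂ / ((supNorm t : ℝ) + 1) ^ 4)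
      ∧ (∀ i j l, |Δ_[(Pi.single i 1 : Pt)] (Δ_[(Pi.single j 1 : Pt)] (Δ_[(Pi.single l 1 : Pt)] (fun w => A 0 w () ()))) t|
          ≤ A₃ / ((supNorm t : ℝ) + 1) ^ 5))
    (hR₀ : 1 ≤ R₀)
    (hDF : ∀ t : Pt, R₀ ≤ supNorm t →
      |A 0 (-t) () () - cG * invSq (toReal t)| ≤ D₀ / (supNorm t : ℝ) ^ 3
      ∧ (∀ i, |Δ_[(Pi.single i 1 : Pt)] (fun w => A 0 (-w) () ()) t - cG * d1InvSq i (toReal t)| ≤ D₁ / (supNorm t : ℝ) ^ 4)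
      ∧ (∀ i j, |Δ_[(Pi.single i 1 : Pt)] (Δ_[(Pi.single j 1 : Pt)] (fun w => A 0 (-w) () ())) t - cG * hessInvSq i j (toReal t)|
          ≤ D₂ / (supNorm t : ℝ) ^ 5))
    (hDG : ∀ t : Pt, R₀ ≤ supNorm t →
      |A 0 t () () - cG * invSq (toReal t)| ≤ D₀ / (supNorm t : ℝ) ^ 3
      ∧ (∀ i, |Δ_[(Pi.single i 1 : Pt)] (fun w => A 0 w () ()) t - cG * d1InvSq i (toReal t)| ≤ D₁ / (supNorm t : ℝ) ^ 4)
      ∧ (∀ i j, |Δ_[(Pi.single i 1 : Pt)] (Δ_[(Pi.single j 1 : Pt)] (fun w => A 0 w () ())) t - cG * hessInvSq i j (toReal t)|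
          ≤ D₂ / (supNorm t : ℝ) ^ 5))
    (hv : ∀ (lam : Fin 4) (u : Site 4), BiLoc (v lam u) u u Cs δ) (hcov : ∀ (lam : Fin 4) (w : Site 4), v lam w = shiftK (-w) (v lam 0))
    (h0 : ∀ lam : Fin 4, ∑' p : Pt × Pt, v lam 0 p.1 p.2 () () = 0)
    (μ ν : Fin 4) {z : Pt} (hz : R₀ ≤ supNorm z) :
    |bubble A (v μ 0) (v ν z) - leadGermSc cG (cubicGermOfSc v) μ ν (toReal z)| ≤ Cbub 1 Cs δ A₀ A₁ A₂ A₃ D₀ D₁ D₂ / (supNorm z : ℝ) ^ 7 := by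
  have hs1 : (1 : ℝ) ≤ supNorm z := by exact_mod_cast le_trans hR₀ hz
  have hs : (0 : ℝ) < supNorm z := by linarith
  set s : ℝ := (supNorm z : ℝ) with hsdef
  set x : E4 := toReal z with hxdef
  -- the engine, fibre `Unit`, degrees a = b = 2
  have h0₀ : ∀ g f : Unit, ∑' p : Pt × Pt, v μ 0 p.1 p.2 g f = 0 := fun _ _ => h0 μ
  have h0₁ : ∀ h a : Unit, ∑' q : Pt × Pt, v ν z q.1 q.2 h a = 0 := fun _ _ => tsum_member_eq_zero_sc hcov h0 ν z
  have hD := abs_bubble_kernel_sub_lead_le (A := A) (V₀ := v μ 0) (V₁ := v ν z) (a := 2) (b := 2) (z := z)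
    hδ hA hT (hv μ 0) (hv ν z) h0₀ h0₁ (fun _ _ t => hF t) (fun _ _ t => hG t)
  simp only [tsum_fst_moment_sc, tsum_snd_moment_sc, tsum_recentred_fst_moment_sc hcov, tsum_recentred_snd_moment_sc hcov] at hD
  set m₀ : Unit → Unit → Idx → Fin 2 → ℝ := fun _ _ κ i => cubicGermOfSc v μ κ i with hm₀def
  set m₁ : Unit → Unit → Idx → Fin 2 → ℝ := fun _ _ κ i => cubicGermOfSc v ν κ i with hm₁def
  set P : Unit → Unit → ℝ := fun _ _ => A 0 (-z) () () with hPdef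
  set Q : Unit → Unit → ℝ := fun _ _ => A 0 z () () with hQdef
  set dF : Idx → Unit → Unit → ℝ := fun i _ _ => Δ_[(Pi.single i 1 : Pt)] (fun w => A 0 (-w) () ()) z with hdFdef
  set dG : Idx → Unit → Unit → ℝ := fun j _ _ => Δ_[(Pi.single j 1 : Pt)] (fun w => A 0 w () ()) z with hdGdef
  set ddF : Idx → Idx → Unit → Unit → ℝ := fun i j _ _ => Δ_[(Pi.single i 1 : Pt)] (Δ_[(Pi.single j 1 : Pt)] (fun w => A 0 (-w) () ())) z with hddFdef
  set ddG : Idx → Idx → Unit → Unit → ℝ := fun i j _ _ => Δ_[(Pi.single i 1 : Pt)] (Δ_[(Pi.single j 1 : Pt)] (fun w => A 0 w () ())) z with hddGdef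
  have hD' : |bubble A (v μ 0) (v ν z) - leadOf m₀ m₁ P Q dF dG ddF ddG|
      ≤ (Fintype.card Unit : ℝ) ^ 4 * KR₂ Cs δ A₀ A₁ A₂ A₃ / ((supNorm z : ℝ) + 1) ^ (2 + 2 + 3) := by
    simpa only [leadOf, KR₂, Finset.univ_unique, Finset.sum_singleton] using hD
  -- the leg replacement
  have hA₀ : 0 ≤ A₀ := nonneg_of_abs_le_div (hG z).1 (by positivity)
  have hA₁ : 0 ≤ A₁ := nonneg_of_abs_le_div ((hG z).2.1 0) (by positivity)
  have hA₂ : 0 ≤ A₂ := nonneg_of_abs_le_div ((hG z).2.2.1 0 0) (by positivity)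
  have hD₀ : 0 ≤ D₀ := nonneg_of_abs_le_div (hDG z hz).1 (by positivity)
  have hD₁ : 0 ≤ D₁ := nonneg_of_abs_le_div ((hDG z hz).2.1 0) (by positivity)
  have hD₂ : 0 ≤ D₂ := nonneg_of_abs_le_div ((hDG z hz).2.2 0 0) (by positivity)
  have hP : ∀ a g, |P a g| ≤ A₀ / s ^ 2 := fun _ _ => ((hF z).1).trans (div_succ_pow_le hA₀ hs 2)
  have hQ : ∀ f h, |Q f h| ≤ A₀ / s ^ 2 := fun _ _ => ((hG z).1).trans (div_succ_pow_le hA₀ hs 2)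
  have hdF : ∀ i a g, |dF i a g| ≤ A₁ / s ^ 3 := fun i _ _ => (((hF z).2.1) i).trans (div_succ_pow_le hA₁ hs 3)
  have hdG : ∀ j f h, |dG j f h| ≤ A₁ / s ^ 3 := fun j _ _ => (((hG z).2.1) j).trans (div_succ_pow_le hA₁ hs 3)
  have hddF : ∀ i j a g, |ddF i j a g| ≤ A₂ / s ^ 4 := fun i j _ _ => (((hF z).2.2.1) i j).trans (div_succ_pow_le hA₂ hs 4)
  have hddG : ∀ i j f h, |ddG i j f h| ≤ A₂ / s ^ 4 := fun i j _ _ => (((hG z).2.2.1) i j).trans (div_succ_pow_le hA₂ hs 4)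
  have eP : ∀ a g : Unit, |P a g - cG * invSq x| ≤ D₀ / s ^ 3 := fun _ _ => (hDF z hz).1
  have eQ : ∀ f h : Unit, |Q f h - cG * invSq x| ≤ D₀ / s ^ 3 := fun _ _ => (hDG z hz).1
  have edF : ∀ (i : Idx) (a g : Unit), |dF i a g - cG * d1InvSq i x| ≤ D₁ / s ^ 4 := fun i _ _ => (hDF z hz).2.1 i
  have edG : ∀ (j : Idx) (f h : Unit), |dG j f h - cG * d1InvSq j x| ≤ D₁ / s ^ 4 := fun j _ _ => (hDG z hz).2.1 j
  have eddF : ∀ (i j : Idx) (a g : Unit), |ddF i j a g - cG * hessInvSq i j x| ≤ D₂ / s ^ 5 := fun i j _ _ => (hDF z hz).2.2 i j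
  have eddG : ∀ (i j : Idx) (f h : Unit), |ddG i j f h - cG * hessInvSq i j x| ≤ D₂ / s ^ 5 := fun i j _ _ => (hDG z hz).2.2 i j
  have hm₀ : ∀ g f κ i, |m₀ g f κ i| ≤ Cs * (Real.exp (δ / 2) * (2 / δ)) * Zl 4 (δ / 2) ^ 2 := fun _ _ κ i => abs_cubicGermOfSc_le hv hδ μ κ i
  have hm₁ : ∀ h a κ i, |m₁ h a κ i| ≤ Cs * (Real.exp (δ / 2) * (2 / δ)) * Zl 4 (δ / 2) ^ 2 := fun _ _ κ i => abs_cubicGermOfSc_le hv hδ ν κ i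
  have hL := abs_leadOf_sub_leadOf_le (P0 := fun (_ _ : Unit) => cG * invSq x) (Q0 := fun (_ _ : Unit) => cG * invSq x)
    (dF0 := fun i (_ _ : Unit) => cG * d1InvSq i x) (dG0 := fun j (_ _ : Unit) => cG * d1InvSq j x)
    (ddF0 := fun i j (_ _ : Unit) => cG * hessInvSq i j x) (ddG0 := fun i j (_ _ : Unit) => cG * hessInvSq i j x)
    hm₀ hm₁ hP hQ hdF hdG hddF hddG eP eQ edF edG eddF eddG
  rw [leadOf_unit_eq_leadGermSc cG (cubicGermOfSc v) μ ν x] at hL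
  -- assemble
  have hKR : 0 ≤ KR₂ Cs δ A₀ A₁ A₂ A₃ := by
    have h1 := nonneg_of_abs_le_div hD' (by positivity)
    exact (mul_nonneg_iff_of_pos_left (by positivity)).mp h1
  have hsum := graded_sum_le hA₀ hA₁ hA₂ hD₀ hD₁ hD₂ hs1
  have hMb : 0 ≤ (Cs * (Real.exp (δ / 2) * (2 / δ)) * Zl 4 (δ / 2) ^ 2) ^ 2 := sq_nonneg _
  calc |bubble A (v μ 0) (v ν z) - leadGermSc cG (cubicGermOfSc v) μ ν x|
      ≤ |bubble A (v μ 0) (v ν z) - leadOf m₀ m₁ P Q dF dG ddF ddG| + |leadOf m₀ m₁ P Q dF dG ddF ddG - leadGermSc cG (cubicGermOfSc v) μ ν x| :=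
        abs_sub_le _ _ _
    _ ≤ (Fintype.card Unit : ℝ) ^ 4 * KR₂ Cs δ A₀ A₁ A₂ A₃ / ((supNorm z : ℝ) + 1) ^ (2 + 2 + 3)
          + (Fintype.card Unit : ℝ) ^ 4 * (16 * ((Cs * (Real.exp (δ / 2) * (2 / δ)) * Zl 4 (δ / 2) ^ 2) ^ 2
              * ((D₀ / s ^ 3 * (A₂ / s ^ 4) + D₀ / s ^ 3 * (D₂ / s ^ 5) + A₀ / s ^ 2 * (D₂ / s ^ 5))
                + (D₁ / s ^ 4 * (A₁ / s ^ 3) + D₁ / s ^ 4 * (D₁ / s ^ 4) + A₁ / s ^ 3 * (D₁ / s ^ 4))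
                + (D₁ / s ^ 4 * (A₁ / s ^ 3) + D₁ / s ^ 4 * (D₁ / s ^ 4) + A₁ / s ^ 3 * (D₁ / s ^ 4))
                + (D₀ / s ^ 3 * (A₂ / s ^ 4) + D₀ / s ^ 3 * (D₂ / s ^ 5) + A₀ / s ^ 2 * (D₂ / s ^ 5))))) := add_le_add hD' hL
    _ ≤ (1 : ℝ) ^ 4 * KR₂ Cs δ A₀ A₁ A₂ A₃ / s ^ 7
          + (1 : ℝ) ^ 4 * (16 * ((Cs * (Real.exp (δ / 2) * (2 / δ)) * Zl 4 (δ / 2) ^ 2) ^ 2 * (Kd A₀ A₁ A₂ D₀ D₁ D₂ / s ^ 7))) := by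
        have e1 : (Fintype.card Unit : ℝ) ^ 4 = (1 : ℝ) ^ 4 := by simp
        rw [e1, show (2 : ℕ) + 2 + 3 = 7 from rfl, ← hsdef]
        refine add_le_add (div_succ_pow_le (mul_nonneg (by norm_num) hKR) hs 7) ?_
        exact mul_le_mul_of_nonneg_left (mul_le_mul_of_nonneg_left (mul_le_mul_of_nonneg_left hsum hMb) (by norm_num)) (by norm_num)
    _ = Cbub 1 Cs δ A₀ A₁ A₂ A₃ D₀ D₁ D₂ / s ^ 7 := by
        unfold Cbub; push_cast; ring

end Ghost

/-! ## §3 The faces H2-ASM-5 consumes: the tadpole under (W-loc) and the `hessKer` germ expansion -/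

section Faces

variable {Φ : Type*} [Fintype Φ]

/-- [folklore] **THE TADPOLE UNDER (W-loc)** (ERRATUM E-FP-8-1 to H2V-DESIGN §2): a quartic table jointly localised in the bond separation,
`BiLoc (W μ 0 ν z) 0 z (Cw·e^{−δ|z|₁}) δ`, against a bounded translation-invariant leg has `|½·tadpole A (W μ 0 ν z)| ≤ ½·|Φ|²·(Cw·e^{−δ|z|₁}·Θ δ 0·CA)`. -/
theorem abs_half_tadpole_le {A : MKer 4 Φ} {W : Fin 4 → Site 4 → Fin 4 → Site 4 → MKer 4 Φ} {CA Cw δ : ℝ} (hδ : 0 < δ)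
    (hA : ∀ x y a b, |A x y a b| ≤ CA) (hT : ∀ w : Site 4, shiftK w A = A)
    (hW : ∀ (μ ν : Fin 4) (z : Pt), BiLoc (W μ 0 ν z) 0 z (Cw * Real.exp (-δ * l1 z)) δ) (μ ν : Fin 4) (z : Pt) :
    |(1 / 2 : ℝ) * tadpole A (W μ 0 ν z)| ≤ (1 / 2 : ℝ) * ((Fintype.card Φ : ℝ) ^ 2 * (Cw * Real.exp (-δ * l1 z) * Θ δ 0 * CA)) := by
  rw [abs_mul, abs_of_pos (by norm_num : (0 : ℝ) < 1 / 2)]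
  exact mul_le_mul_of_nonneg_left (abs_tadpole_le hδ hA hT (hW μ ν z)) (by norm_num)

/-- [folklore] the `hessKer` triangle: `|½t − ½b − (−½)·L| ≤ |½t| + ½·|b − L|`. -/
theorem abs_hessKer_shape_le (t b L : ℝ) : |(1 / 2 : ℝ) * t - (1 / 2 : ℝ) * b - (-(1 / 2 : ℝ)) * L| ≤ |(1 / 2 : ℝ) * t| + (1 / 2 : ℝ) * |b - L| := by
  have e : (1 / 2 : ℝ) * t - (1 / 2 : ℝ) * b - (-(1 / 2 : ℝ)) * L = (1 / 2 : ℝ) * t + (-(1 / 2 : ℝ)) * (b - L) := by ring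
  rw [e]
  refine (abs_add_le _ _).trans (add_le_add le_rfl (le_of_eq ?_))
  rw [abs_mul, abs_neg, abs_of_pos (by norm_num : (0 : ℝ) < 1 / 2)]

end Faces

end Summit.QuantumFields.BalabanUV.Beta.FP.PolarizationGerm

end
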